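import Literature.MathematicalPhysics.QuantumFieldTheory.Balaban1983to89.B9Eq365QGGQLowerVariationalWindowSharp
import Literature.MathematicalPhysics.QuantumFieldTheory.Balaban1983to89.B9Eq365QGGQLowerVariationalSharpFloor

/-!
# `Balaban1983to89.B9Eq365QGGQLowerVariationalWindowSharpScaled` — T. Bałaban, *Propagators for lattice gauge theories in a background field*, Commun.
# Math. Phys. **99** (1985) 389–434 [Balaban1985BackgroundPropagators] Thm 3.11 p. 416 with (3.16) p. 393, (3.24)–(3.25) p. 394, (3.35) p. 396, and
# [Balaban1984PropagatorsII] (2.74)–(2.77) p. 236: **THE ONE-SHOT THIRD OPERATOR ON PRINT's DIAGONAL `ηL = 1`, `c₀L^d = c₁` AT THE SCALED EDGE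
# `‖U(b) − 1‖ ≤ αη`: THE PEDESTAL FLOOR `κ♯₀(d, a′) = 1∕(36(24d(6∕5)^{d−1} + 1 + 9a′∕4)²)` — `9.7·10⁻⁷` AT `d = 4`, `a′ = 1` — FOR EVERY BLOCK RATIO `L ≥ 1`,
# AND `∃ α₁ κ > 0` BEFORE `∀ L`** — the sharp companion of this seat's `B9Eq365QGGQLowerVariationalWindowUniform` (tent, `5.8·10⁻²⁰`, `L ≥ 3`): the
# one-shot number of the pub-balaban NE9 refuter desk's KAPPA1 moves by thirteen orders of magnitude

statement-level skeleton of published theorems with citation tags; proofs where landed; nothing here is a claim about the Yang–Mills mass gap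

CITATION HEADER (lean-in-tree rule).  Audit cell `pub-balaban`, sub-cell `t4`, BINDER row NE9; filed by NE9 crux-team LEAF PROVER 03
(`b2b-balaban-t4-ne9-formalise-leaf-03`, gen 73).  Composition BY NAME of this seat's `B9Eq365QGGQLowerVariationalWindowSharp.qggq_coercive_window_sharp`
(closed form) and `B9Eq365QGGQLowerVariationalSharpFloor.kappa_sharp_floor` ∕ `window_of_ratio_sharp` (pure reals).  Sources READ: as the prequels.

WHAT IS PROVED (sorry-free; proof lane — 0 `def`; [folklore] threshold arithmetic).
* **`qggq_coercive_window_sharp_scaled`** — for `ηL = 1`, `c₀L^d = c₁`, a background with `U(b) ∈ U1`, `‖U(b) − 1‖ ≤ αη`, mutually adjoint transporters,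
  the displayed positivity `hpos′`, `0 ≤ α` and the two `L`-FREE windows `exp(dKα) − 1 ≤ (10∕21)^d∕2`, `dK²α²(441∕100)^d ≤ 1∕2` (`K = 2M_φM_φ′`;
  `ρ′ = (1 + Kαη)^{d(L−1)} − 1 ≤ exp(dKα) − 1` since `ηL = 1`): `κ♯₀·‖ψ‖² ≤ re⟪ψ, Q̃′(U)G′(U)²Q̃′(U)†ψ⟫` — leaf-06's `QGGQ_pos` operator VERBATIM,
  EVERY `L ≥ 1`.
* **`exists_qggq_coercive_window_sharp_scaled`** — `∃ α₁ κ > 0` (closed forms in `(d, a′, K)`) BEFORE `∀ L ≥ 1, η (ηL = 1), c₀, c₁ (c₀L^d = c₁), m, U, α ≤ α₁,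
  hpos′, ψ`: `κ‖ψ‖² ≤ re⟪ψ, Q̃′(U)G′(U)²Q̃′(U)†ψ⟫`.
HONEST SCOPE.  Packaging; `κ♯₀` is the cell's variational floor, NOT print's constant; `hRS`, `U1`, the edge DISPLAYED ((3.35)); `L²` floor only — NOT the
kernel decay; NOT NE9 (cell pub-balaban: NE9 NOT PRINTED ∕ NOT PROVED; «NE9 ⇐ the named binders»; row WALLED ON A MODEL (O-NE9-1; #5 UNRULED); spine PROVED
0∕9; rung (B)+1 on a finite T⁴ — NOT infinite volume, NOT mass gap, NOT BetaPertH, NOT Clay; HONEST DEPENDENCY: continuum YM on T⁴ ⇐ BetaPertH ∧ nine spine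
estimates (0/9 proved); BetaPertH ⇐ (D1) ∧ (D4) ∧ CAP+tail; G-an2-4 gates asym, D1 and NE2/3/4).  NEW file importing the two prequels; nothing modified.
Net new unproved facts: 0.
-/

noncomputable section

open scoped InnerProductSpace ComplexConjugate BigOperators

namespace Literature.MathematicalPhysics.QuantumFieldTheory.Balaban1983to89.B9Eq365QGGQLowerVariationalWindowSharpScaled

open B4Sect5Torus (TSite)
open B9SectCLatticeCarrier (Bond)
open B7Prop1Explicit (U1)
open B9Eq311L2Pairing (WL2)
open B9Eq319QprimeTorus (fineP)
open B11Eq103H1Complex (SiteL2K)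
open B9Eq310HessianOperator (adTransportW)
open B9Eq326OperatorAssembly (QprimeW)
open B9Eq3119DeltaPiCarrier (laplacePrimeA GpOfU)
open B9Eq365QGGQLowerVariationalWindowSharp (qggq_coercive_window_sharp)
open B9Eq365QGGQLowerVariationalSharpFloor (kappa_sharp_floor window_of_ratio_sharp)

/-! ## §1 The one-shot pedestal floor on the diagonal at the scaled edge: one constant for every block ratio `L ≥ 1` -/

section Scaled

variable {d : ℕ} (L : ℕ) [NeZero L] (m : Fin d → ℕ) [∀ i, NeZero (fineP L m i)]
  {𝔸 : Type*} [NormedRing 𝔸] [NormedAlgebra ℂ 𝔸] [NormOneClass 𝔸] {W : Type*} [NormedAddCommGroup W] [InnerProductSpace ℂ W]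
  [FiniteDimensional ℂ W] (φ : W ≃ₗ[ℂ] 𝔸) (c₀ : ℝ) [Fact (0 < c₀)] (η : ℝ) (c₁ : ℝ) [Fact (0 < c₁)]

/-- **THE ONE-SHOT THIRD OPERATOR ON THE DIAGONAL AT THE SCALED EDGE, PEDESTAL FLOOR — ONE CONSTANT `κ♯₀(d, a′)` FOR EVERY BLOCK RATIO `L ≥ 1`**: for
`ηL = 1`, `c₀L^d = c₁`, `U(b) ∈ U1`, `‖U(b) − 1‖ ≤ αη`, mutually adjoint transporters, the displayed positivity `hpos′`, `0 ≤ α` and the `L`-FREE windows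
`exp(dKα) − 1 ≤ (10∕21)^d∕2`, `dK²α²(441∕100)^d ≤ 1∕2` (`K = 2M_φM_φ′`): `κ♯₀·‖ψ‖² ≤ re⟪ψ, Q̃′(U)G′(U)²Q̃′(U)†ψ⟫`, `κ♯₀ = 1∕(36Λ♯²)`,
`Λ♯ = 24d(6∕5)^{d−1} + 1 + 9a′∕4`. [cite: Balaban1985BackgroundPropagators, Thm 3.11 p.416, (3.24)–(3.25) p.394, (3.16) p.393, (3.35) p.396; Balaban1984PropagatorsII, (2.74)–(2.77) p.236] -/
theorem qggq_coercive_window_sharp_scaled {a' : ℝ} (ha' : 0 < a') {Mφ Mφ' : ℝ} (hMφ : 0 ≤ Mφ) (hMφ' : 0 ≤ Mφ')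
    (hφ : ∀ w, ‖φ w‖ ≤ Mφ * ‖w‖) (hφ' : ∀ X, ‖φ.symm X‖ ≤ Mφ' * ‖X‖)
    (U : Bond d (fineP L m) → 𝔸ˣ) (hU : ∀ b, U b ∈ U1 𝔸) {α : ℝ} (hα0 : 0 ≤ α) (hUε : ∀ b, ‖(U b : 𝔸) - 1‖ ≤ α * η)
    (hRS : ∀ (b : Bond d (fineP L m)) (v u : W), ⟪adTransportW φ U b v, u⟫_ℂ = ⟪v, adTransportW φ (fun b => (U b)⁻¹) b u⟫_ℂ)
    (hpos' : ∀ x : SiteL2K ℂ d (fineP L m) c₀ W, x ≠ 0 → 0 < RCLike.re ⟪x, laplacePrimeA L m φ η U a' (c₁ := c₁) x⟫_ℂ)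
    (hηL : η * (L : ℝ) = 1) (hw : c₀ * (L : ℝ) ^ d = c₁)
    (hwin : Real.exp ((d : ℝ) * (2 * Mφ * Mφ') * α) - 1 ≤ (10 / 21 : ℝ) ^ d / 2)
    (hKα : (d : ℝ) * (2 * Mφ * Mφ') ^ 2 * α ^ 2 * (441 / 100) ^ d ≤ 1 / 2) (ψ : SiteL2K ℂ d m c₁ W) :
    1 / (36 * (24 * (d : ℝ) * (6 / 5) ^ (d - 1) + 1 + 9 * a' / 4) ^ 2) * ‖ψ‖ ^ 2 ≤
      RCLike.re ⟪ψ, (((WL2.linearEquiv ℂ ℂ (fun _ : TSite d m => c₁)).symm.toLinearMap ∘ₗ QprimeW L m φ U (c₀ := c₀)) ∘ₗ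
        GpOfU L m φ η U a' (c₁ := c₁) hpos' ∘ₗ GpOfU L m φ η U a' (c₁ := c₁) hpos' ∘ₗ
        LinearMap.adjoint ((WL2.linearEquiv ℂ ℂ (fun _ : TSite d m => c₁)).symm.toLinearMap ∘ₗ QprimeW L m φ U (c₀ := c₀))) ψ⟫_ℂ := by
  have hc₀ : 0 < c₀ := Fact.out
  have hc₁ : 0 < c₁ := Fact.out
  have hL1 : (1 : ℝ) ≤ L := by exact_mod_cast Nat.pos_of_ne_zero (NeZero.ne L)
  have hL0 : (0 : ℝ) < L := by linarith
  have hη0 : 0 < η := pos_of_mul_pos_left (by rw [hηL]; exact one_pos) hL0.le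
  have hK0 : 0 ≤ 2 * Mφ * Mφ' := by positivity
  set ρ' : ℝ := (1 + 2 * Mφ * Mφ' * (α * η)) ^ (d * (L - 1)) - 1 with hρ'
  have hρ0 : 0 ≤ ρ' := by rw [hρ']; exact sub_nonneg.2 (one_le_pow₀ (by nlinarith [mul_nonneg hK0 (mul_nonneg hα0 hη0.le)]))
  -- `ρ′ ≤ exp(dKα) − 1`: `(1 + Kαη)^{d(L−1)} ≤ exp(d(L−1)·Kαη) ≤ exp(dL·Kαη) = exp(dKα)` by `ηL = 1`
  have hρle : ρ' ≤ (10 / 21 : ℝ) ^ d / 2 := by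
    have hp : ((d * (L - 1) : ℕ) : ℝ) ≤ (d : ℝ) * L := by
      have h : d * (L - 1) ≤ d * L := Nat.mul_le_mul_left d (Nat.sub_le L 1)
      exact_mod_cast h
    have hx0 : 0 ≤ 2 * Mφ * Mφ' * (α * η) := by positivity
    have h1 : (1 + 2 * Mφ * Mφ' * (α * η)) ^ (d * (L - 1)) ≤ Real.exp (((d * (L - 1) : ℕ) : ℝ) * (2 * Mφ * Mφ' * (α * η))) := by
      rw [Real.exp_nat_mul]
      exact pow_le_pow_left₀ (by positivity) (by linarith [Real.add_one_le_exp (2 * Mφ * Mφ' * (α * η))]) _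
    have h2 : ((d * (L - 1) : ℕ) : ℝ) * (2 * Mφ * Mφ' * (α * η)) ≤ (d : ℝ) * (2 * Mφ * Mφ') * α :=
      calc ((d * (L - 1) : ℕ) : ℝ) * (2 * Mφ * Mφ' * (α * η)) ≤ (d : ℝ) * L * (2 * Mφ * Mφ' * (α * η)) :=
            mul_le_mul_of_nonneg_right hp hx0
        _ = (d : ℝ) * (2 * Mφ * Mφ') * α * (η * L) := by ring
        _ = (d : ℝ) * (2 * Mφ * Mφ') * α := by rw [hηL, mul_one]
    rw [hρ']
    linarith [h1.trans (Real.exp_le_exp.2 h2)]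
  have hwin' : ρ' * ((L : ℝ) / 2 + (L : ℝ) ^ 2 / 4) ^ d ≤ 1 / 2 * (((L : ℝ) ^ 2 + 2) / 6) ^ d := by
    have h := window_of_ratio_sharp hL0.le d hρle
    linarith
  have key := qggq_coercive_window_sharp L m φ c₀ η c₁ ha' hMφ hMφ' hφ hφ' U hU (ε := α * η) (by positivity) hUε hRS hpos'
    (θ := 1 / 2) (t := 1) (by norm_num) one_pos hwin' ψ
  -- the diagonal readings `|η⁻¹| = L`, `c₀L^d∕c₁ = 1`, `c₀∕c₁ = L^{−d}`, `|η⁻¹|·Kαη = Kα`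
  have hηinv : ‖((η : ℂ))⁻¹‖ = (L : ℝ) := by
    rw [norm_inv, Complex.norm_real, Real.norm_eq_abs, abs_of_pos hη0,
      show η = ((L : ℝ))⁻¹ by rw [← one_div]; field_simp; linarith [hηL], inv_inv]
  have hρw1 : c₀ * (L : ℝ) ^ d / c₁ = 1 := by rw [hw, div_self hc₁.ne']
  have hv : c₀ / c₁ = ((L : ℝ) ^ d)⁻¹ := by rw [← hw]; field_simp
  have he : ‖((η : ℂ))⁻¹‖ * (2 * Mφ * Mφ' * (α * η)) ≤ 2 * Mφ * Mφ' * α := by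
    rw [hηinv, show (L : ℝ) * (2 * Mφ * Mφ' * (α * η)) = 2 * Mφ * Mφ' * α * (η * (L : ℝ)) by ring, hηL, mul_one]
  have hfloor := kappa_sharp_floor (d := d) hL1 ha' (by positivity : 0 ≤ 2 * Mφ * Mφ' * (α * η)) hηinv hρw1 hv he hρ0 hwin' hKα
  exact le_trans (mul_le_mul_of_nonneg_right hfloor (sq_nonneg _)) key

end Scaled

/-! ## §2 `∃ α₁ κ > 0` before every block ratio `L ≥ 1` -/

section Exists

variable {d : ℕ} {𝔸 : Type*} [NormedRing 𝔸] [NormedAlgebra ℂ 𝔸] [NormOneClass 𝔸] {W : Type*} [NormedAddCommGroup W] [InnerProductSpace ℂ W]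
  [FiniteDimensional ℂ W] (φ : W ≃ₗ[ℂ] 𝔸) {a' Mφ Mφ' : ℝ} (ha' : 0 < a') (hMφ : 0 ≤ Mφ) (hMφ' : 0 ≤ Mφ')
  (hφ : ∀ w, ‖φ w‖ ≤ Mφ * ‖w‖) (hφ' : ∀ X, ‖φ.symm X‖ ≤ Mφ' * ‖X‖)

/-- `exp y − 1 ≤ 2y` on `0 ≤ y ≤ 1` (private arithmetic helper). [folklore] -/
private theorem exp_sub_one_le_two_mul {y : ℝ} (hy0 : 0 ≤ y) (hy1 : y ≤ 1) : Real.exp y - 1 ≤ 2 * y := by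
  have h := Real.abs_exp_sub_one_sub_id_le (x := y) (by rw [abs_of_nonneg hy0]; exact hy1)
  have h' : Real.exp y - 1 - y ≤ y ^ 2 := (le_abs_self _).trans h
  nlinarith

include ha' hMφ hMφ' hφ hφ' in
/-- **KAPPA1, ONE-SHOT HALF, SHARP SIZE — `∃ α₁ κ > 0` BEFORE EVERY BLOCK RATIO `L ≥ 1`, LATTICE AND BACKGROUND**: with `K = 2M_φM_φ′`, `c = dK`,
`α₁ = min (min 1 ((10∕21)^d∕(4(c+1)))) (1∕(2(c+1)·(21∕10)^d))` and `κ = κ♯₀(d, a′) = 1∕(36(24d(6∕5)^{d−1} + 1 + 9a′∕4)²)`: for every `L ≥ 1`, `η` on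
`ηL = 1`, weights `c₀L^d = c₁`, period `m`, background `U` (mutually adjoint transporters, `U(b) ∈ U1`, `‖U(b) − 1‖ ≤ αη`), every `0 ≤ α ≤ α₁`, every
positivity witness and every coarse `ψ`: `κ·‖ψ‖² ≤ re⟪ψ, Q̃′(U)G′(U)²Q̃′(U)†ψ⟫`.
[cite: Balaban1985BackgroundPropagators, Thm 3.11 p.416, (3.24)–(3.25) p.394, (3.35) p.396; Balaban1984PropagatorsII, (2.74)–(2.77) p.236] -/
theorem exists_qggq_coercive_window_sharp_scaled :
    ∃ α₁ κ : ℝ, 0 < α₁ ∧ 0 < κ ∧ ∀ (L : ℕ) [NeZero L] (η : ℝ), η * (L : ℝ) = 1 →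
      ∀ (c₀ c₁ : ℝ) [Fact (0 < c₀)] [Fact (0 < c₁)], c₀ * (L : ℝ) ^ d = c₁ →
      ∀ (m : Fin d → ℕ) [∀ i, NeZero (fineP L m i)] (U : Bond d (fineP L m) → 𝔸ˣ),
        (∀ (b : Bond d (fineP L m)) (v u : W), ⟪adTransportW φ U b v, u⟫_ℂ = ⟪v, adTransportW φ (fun b => (U b)⁻¹) b u⟫_ℂ) →
      ∀ (α : ℝ), 0 ≤ α → α ≤ α₁ → (∀ b, U b ∈ U1 𝔸) → (∀ b, ‖(U b : 𝔸) - 1‖ ≤ α * η) →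
      ∀ (hpos' : ∀ x : SiteL2K ℂ d (fineP L m) c₀ W, x ≠ 0 → 0 < RCLike.re ⟪x, laplacePrimeA L m φ η U a' (c₁ := c₁) x⟫_ℂ)
        (ψ : SiteL2K ℂ d m c₁ W),
        κ * ‖ψ‖ ^ 2 ≤
          RCLike.re ⟪ψ, (((WL2.linearEquiv ℂ ℂ (fun _ : TSite d m => c₁)).symm.toLinearMap ∘ₗ QprimeW L m φ U (c₀ := c₀)) ∘ₗ
            GpOfU L m φ η U a' (c₁ := c₁) hpos' ∘ₗ GpOfU L m φ η U a' (c₁ := c₁) hpos' ∘ₗ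
            LinearMap.adjoint ((WL2.linearEquiv ℂ ℂ (fun _ : TSite d m => c₁)).symm.toLinearMap ∘ₗ QprimeW L m φ U (c₀ := c₀))) ψ⟫_ℂ := by
  obtain ⟨c, hc0, hcdef⟩ : ∃ c : ℝ, 0 ≤ c ∧ c = (d : ℝ) * (2 * Mφ * Mφ') := ⟨_, by positivity, rfl⟩
  have hX1 : (10 / 21 : ℝ) ^ d ≤ 1 := pow_le_one₀ (by norm_num) (by norm_num)
  have hY1 : (1 : ℝ) ≤ (21 / 10 : ℝ) ^ d := one_le_pow₀ (by norm_num)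
  refine ⟨min (min 1 ((10 / 21 : ℝ) ^ d / (4 * (c + 1)))) (1 / (2 * (c + 1) * (21 / 10 : ℝ) ^ d)),
    1 / (36 * (24 * (d : ℝ) * (6 / 5) ^ (d - 1) + 1 + 9 * a' / 4) ^ 2),
    lt_min (lt_min one_pos (by positivity)) (by positivity), by positivity, ?_⟩
  intro L _ η hηL c₀ c₁ _ _ hw m _ U hRS α hα0 hαle hUb hUε hpos' ψ
  have hα1 : α ≤ 1 := hαle.trans ((min_le_left _ _).trans (min_le_left _ _))
  have hαc : α * (4 * (c + 1)) ≤ (10 / 21 : ℝ) ^ d :=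
    (le_div_iff₀ (by positivity)).1 (hαle.trans ((min_le_left _ _).trans (min_le_right _ _)))
  have hαK : α * (2 * (c + 1) * (21 / 10 : ℝ) ^ d) ≤ 1 := (le_div_iff₀ (by positivity)).1 (hαle.trans (min_le_right _ _))
  have hy0 : 0 ≤ c * α := mul_nonneg hc0 hα0
  have hcα : c * α ≤ (c + 1) * α := mul_le_mul_of_nonneg_right (by linarith) hα0
  have hy1 : c * α ≤ 1 := by linarith [hcα, hαc, hX1]
  have hwin : Real.exp ((d : ℝ) * (2 * Mφ * Mφ') * α) - 1 ≤ (10 / 21 : ℝ) ^ d / 2 := by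
    rw [show (d : ℝ) * (2 * Mφ * Mφ') * α = c * α by rw [hcdef]]
    calc Real.exp (c * α) - 1 ≤ 2 * (c * α) := exp_sub_one_le_two_mul hy0 hy1
      _ ≤ (10 / 21 : ℝ) ^ d / 2 := by linarith [hcα, hαc]
  -- `dK²α²(441∕100)^d = (cα)·(Kα)·(21∕10)^{2d}∕… ≤ 1∕2`: from `(c+1)α(21∕10)^d ≤ 1∕2` twice (`Kα ≤ (c+1)α` needs `K ≤ c + 1`, i.e. `d ≥ 1` or slack)
  have hKα : (d : ℝ) * (2 * Mφ * Mφ') ^ 2 * α ^ 2 * (441 / 100) ^ d ≤ 1 / 2 := by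
    have hK0 : 0 ≤ 2 * Mφ * Mφ' := by positivity
    have e441 : (441 / 100 : ℝ) ^ d = ((21 / 10 : ℝ) ^ d) ^ 2 := by rw [← pow_mul, mul_comm, pow_mul]; norm_num
    rw [e441]
    -- `dK·α·(21∕10)^d ≤ (c+1)α(21∕10)^d ≤ 1∕2` and `K·α·(21∕10)^d ≤ (c+1)·α·(21∕10)^d ≤ 1∕2` when `K ≤ c + 1`; if `d = 0` the left side is `0`.
    rcases Nat.eq_zero_or_pos d with hd | hd
    · subst hd; simp
    · have hd1 : (1 : ℝ) ≤ d := by exact_mod_cast hd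
      have hKc : 2 * Mφ * Mφ' ≤ c + 1 := by rw [hcdef]; nlinarith
      have h1 : c * α * (21 / 10 : ℝ) ^ d ≤ 1 / 2 := by nlinarith [hcα, hαK, hY1]
      have h2 : (2 * Mφ * Mφ') * α * (21 / 10 : ℝ) ^ d ≤ 1 / 2 := by
        have := mul_le_mul_of_nonneg_right (mul_le_mul_of_nonneg_right hKc hα0) (by positivity : (0 : ℝ) ≤ (21 / 10 : ℝ) ^ d)
        nlinarith [hαK]
      have h0a : 0 ≤ c * α * (21 / 10 : ℝ) ^ d := by positivity
      have h0b : 0 ≤ (2 * Mφ * Mφ') * α * (21 / 10 : ℝ) ^ d := by positivity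
      calc (d : ℝ) * (2 * Mφ * Mφ') ^ 2 * α ^ 2 * ((21 / 10 : ℝ) ^ d) ^ 2
          = (c * α * (21 / 10 : ℝ) ^ d) * ((2 * Mφ * Mφ') * α * (21 / 10 : ℝ) ^ d) := by rw [hcdef]; ring
        _ ≤ (1 / 2) * (1 / 2) := mul_le_mul h1 h2 h0b (by norm_num)
        _ ≤ 1 / 2 := by norm_num
  exact qggq_coercive_window_sharp_scaled L m φ c₀ η c₁ ha' hMφ hMφ' hφ hφ' U hUb hα0 hUε hRS hpos' hηL hw hwin hKα ψ

end Exists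

end Literature.MathematicalPhysics.QuantumFieldTheory.Balaban1983to89.B9Eq365QGGQLowerVariationalWindowSharpScaled

end
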